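import Summits.MatrixMultiplication.OmegaCensus.SmallFormats.InvertiblePointNearLaw
import HarnessLib

/-!
# ω-census family (a): the HALF LAW — `11n ≤ 2r + 2p` at every invertible point of an `r`-term `⟨2,2,n⟩` scheme (any field)

Cell `pub-omega` (unit `pub-omega-tensor`, gen 35), topic `Summits/MatrixMultiplication/OmegaCensus` (sub-folder
`SmallFormats`). Framing (verbatim): lottery ticket; floor = certified bounds/negative ranges. HONEST FRAMING: the split of
`InvertiblePointNearSplit` (p664043) ITERATED, fed into the refined δ-law (`InvertiblePointDeltaLawRefined`, p664488) with the
K-side bookkeeping of `InvertiblePointNearLaw` (p665960): at `X₀ = 1` with `|O| = 2n + d` nonvanishing X-forms, `d` successive splits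
produce a SATURATED scheme with `r + 2d` terms whose vanishing Y-forms all lie in the span of the original `g_t` (`t ∉ O`) and the
`d` removed `g_{j}` — so their common kernel keeps dimension `≥ 4n − r` — while the vanishing outputs number `r − 2n + 2d`. Hence
(`finrank_add_three_mul_le`) `dim K + 3n ≤ |ι| + 3d` for every `K` killed by the `g_t`, `t ∉ O`, and
**the half law** (`eleven_mul_le`): at every invertible point with `p` nonvanishing X-forms, `11n ≤ 2r + 2p`, i.e.
`p ≥ 2n + (7n − 2r)/2` — twice the gain of the quarter law `15n ≤ 2r + 4p` of p664043 (`d = 0`: the final δ-law; `d = 1`: the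
near-point law `7n ≤ 2r + 2`). Census instances (`𝔽₃` floor rungs `(n, ⌈36n/11⌉)`): 36-term `⟨2,2,11⟩` — at least 25 = 2n + 3 of the
36 X-forms are nonzero at every invertible point (at most 11 vanish); 43-term `⟨2,2,13⟩` ≥ 29; 56-term `⟨2,2,17⟩` ≥ 38; 72-term
`⟨2,2,22⟩` ≥ 49. Nothing here is a bound on `ω`; the count-level consequences (X-marginal census) are not in this file.
-/

namespace Summit.MatrixMultiplication.OmegaCensus.SmallFormats

open Module Matrix Literature.Computability.AlgebraicComplexity
open Summit.MatrixMultiplication.OmegaCensus.RankOnePlaneCapGeneral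

namespace NearSplit

variable {k : Type*} [Field k] {n : ℕ}

/-- Cutting a subspace by one linear form costs at most one dimension. -/
theorem finrank_le_finrank_inf_ker_add_one {V : Type*} [AddCommGroup V] [Module k V] [FiniteDimensional k V]
    (K : Submodule k V) (g : Module.Dual k V) : finrank k K ≤ finrank k ↥(K ⊓ LinearMap.ker g) + 1 := by
  have h1 := Submodule.finrank_sup_add_finrank_inf_eq K (LinearMap.ker g)
  have h2 := LinearMap.finrank_range_add_finrank_ker g
  have h3 : finrank k (LinearMap.range g) ≤ 1 := (Submodule.finrank_le _).trans (by rw [Module.finrank_self])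
  have h4 : finrank k ↥(K ⊔ LinearMap.ker g) ≤ finrank k V := Submodule.finrank_le _
  omega

/-- **Iterated split (field with enough points).** At `X₀ = 1` with `|O| = 2n + d`: every subspace `K` killed by all `g_t`, `t ∉ O`,
has `dim K + 3n ≤ |ι| + 3d`. (Induction on `d`: the split lowers `d` by one, raises `|ι|` by two, and `K ∩ ker g_{j₀}` — of dimension
`≥ dim K − 1` — is killed by the new vanishing forms; `d = 0` is the refined δ-law with `dim span{W_t} ≤ |Z|`.) -/
theorem finrank_add_three_mul_le (P : ℕ) (xs : Fin (P + 1) → (Fin 2 → k))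
    (hxs : ∀ i j, i ≠ j → xs i 0 * xs j 1 - xs i 1 * xs j 0 ≠ 0) (d : ℕ) :
    ∀ {ι : Type*} [Fintype ι] [DecidableEq ι], Fintype.card ι + 2 * d ≤ P →
      ∀ (β : BilinComp (mulBilin k 2 2 n) ι) (O : Finset ι),
      (∀ i, i ∉ O → β.f i 1 = 0) → (∀ i ∈ O, β.f i 1 ≠ 0) → O.card = 2 * n + d →
      ∀ (K : Submodule k (Matrix (Fin 2) (Fin n) k)), (∀ W ∈ K, ∀ t, t ∉ O → β.g t W = 0) →
      finrank k K + 3 * n ≤ Fintype.card ι + 3 * d := by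
  induction d with
  | zero =>
    intro ι _ _ hP β O hO hO' hcard K hK
    have h := DeltaLaw.finrank_ker_add_le_finrank_span P xs hxs (by omega) β O hO hO' (by omega)
    set K₀ := LinearMap.ker (LinearMap.pi fun t : ↥(Finset.univ \ O) => β.g (t : ι)) with hK₀
    have hKle : K ≤ K₀ := by
      intro W hW
      rw [hK₀, LinearMap.mem_ker]
      funext t
      simpa using hK W hW t (Finset.mem_sdiff.mp t.2).2
    have h1 := Submodule.finrank_mono hKle
    have h2 : finrank k ↥(Submodule.span k (Set.range fun t : ↥(Finset.univ \ O) => β.w (t : ι))) ≤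
        Fintype.card ι - O.card := by
      refine (finrank_range_le_card _).trans ?_
      rw [Fintype.card_coe, Finset.card_sdiff, Finset.inter_univ, Finset.card_univ]
    have h3 : O.card ≤ Fintype.card ι := Finset.card_le_univ O
    omega
  | succ d ih =>
    intro ι _ _ hP β O hO hO' hcard K hK
    classical
    obtain ⟨ρ, hrel, j₀, hj₀, hρ⟩ := exists_relation β O (by omega)
    let β' := split (β := β) (ρ := ρ) (j₀ := j₀) O hO hO' hrel hj₀ hρ
    set O' : Finset (ι ⊕ Fin 2) := (O.erase j₀).map Function.Embedding.inl with hO'def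
    have hcard' : O'.card = 2 * n + d := by
      rw [hO'def, Finset.card_map, Finset.card_erase_of_mem hj₀, hcard]; omega
    set K' : Submodule k (Matrix (Fin 2) (Fin n) k) := K ⊓ LinearMap.ker (β.g j₀) with hK'def
    have hK' : ∀ W ∈ K', ∀ t, t ∉ O' → β'.g t W = 0 := by
      intro W hW t ht
      obtain ⟨hWK, hWj⟩ := Submodule.mem_inf.mp hW
      rw [LinearMap.mem_ker] at hWj
      rcases t with s | i
      · change splitG β ρ j₀ (Sum.inl s) W = 0
        by_cases hs : s = j₀
        · simp only [splitG, Sum.elim_inl, if_pos hs, LinearMap.smul_apply, hWj, smul_zero]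
        · have hsO : s ∉ O := by
            intro hsO
            exact ht (Finset.mem_map.mpr ⟨s, Finset.mem_erase.mpr ⟨hs, hsO⟩, rfl⟩)
          simp only [splitG, Sum.elim_inl, if_neg hs, LinearMap.sub_apply, LinearMap.smul_apply, hK W hWK s hsO, hWj,
            smul_zero, sub_zero]
      · change splitG β ρ j₀ (Sum.inr i) W = 0
        simp only [splitG, Sum.elim_inr, LinearMap.smul_apply, hWj, smul_zero]
    have hP' : Fintype.card (ι ⊕ Fin 2) + 2 * d ≤ P := by rw [Fintype.card_sum, Fintype.card_fin]; omega
    have h := ih hP' β' O' (split_f_one_eq_zero O hO hO' hrel hj₀ hρ) (split_f_one_ne_zero O hO hO' hrel hj₀ hρ) hcard' K' hK'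
    rw [Fintype.card_sum, Fintype.card_fin] at h
    have hcut := finrank_le_finrank_inf_ker_add_one K (β.g j₀)
    rw [← hK'def] at hcut
    omega

/-- **`|O| = 2n + d` at `X₀ = 1` forces `7n ≤ 2r + 2d`** (field with more than `|ι| + 2d` pairwise independent vectors in `k²`):
the iterated split with `K = ⋂_{t∉O} ker g_t`, `dim K ≥ 2n − |Z| = 4n − r + d`. -/
theorem seven_mul_le_two_mul_add_two_mul_one (P : ℕ) (xs : Fin (P + 1) → (Fin 2 → k))
    (hxs : ∀ i j, i ≠ j → xs i 0 * xs j 1 - xs i 1 * xs j 0 ≠ 0) (d : ℕ) {ι : Type*} [Fintype ι] [DecidableEq ι]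
    (hP : Fintype.card ι + 2 * d ≤ P) (β : BilinComp (mulBilin k 2 2 n) ι) (O : Finset ι)
    (hO : ∀ i, i ∉ O → β.f i 1 = 0) (hO' : ∀ i ∈ O, β.f i 1 ≠ 0) (hcard : O.card = 2 * n + d) :
    7 * n ≤ 2 * Fintype.card ι + 2 * d := by
  classical
  set K₀ := LinearMap.ker (LinearMap.pi fun t : ↥(Finset.univ \ O) => β.g (t : ι)) with hK₀
  have hK : ∀ W ∈ K₀, ∀ t, t ∉ O → β.g t W = 0 := by
    intro W hW t ht
    rw [hK₀, LinearMap.mem_ker] at hW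
    have := congr_fun hW ⟨t, Finset.mem_sdiff.mpr ⟨Finset.mem_univ t, ht⟩⟩
    simpa using this
  have h := finrank_add_three_mul_le P xs hxs d hP β O hO hO' hcard K₀ hK
  have hdim := two_mul_le_finrank_ker_add_card β (Finset.univ \ O)
  rw [Finset.card_sdiff, Finset.inter_univ, Finset.card_univ, ← hK₀] at hdim
  have hOle : O.card ≤ Fintype.card ι := Finset.card_le_univ O
  omega

section AnyField

variable {ι : Type*} [Fintype ι] [DecidableEq ι] [DecidableEq k]

/-- **THE HALF LAW (any field, any invertible point).** For an `r`-term bilinear computation of `⟨2,2,n⟩` and an invertible `X₀`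
at which `p` X-forms are nonzero: `11n ≤ 2r + 2p`, i.e. `p ≥ 2n + (7n − 2r)/2`. (Base change to the algebraic closure, transport of
`X₀` to `1`, `seven_mul_le_two_mul_add_two_mul_one` with `d = p − 2n`.) -/
theorem eleven_mul_le (β : BilinComp (mulBilin k 2 2 n) ι) (X₀ : Matrix (Fin 2) (Fin 2) k) (hX₀ : IsUnit X₀.det) :
    11 * n ≤ 2 * Fintype.card ι + 2 * (Finset.univ.filter fun i => β.f i X₀ ≠ 0).card := by
  classical
  have hcap : 2 * n ≤ (Finset.univ.filter fun i => β.f i X₀ ≠ 0).card := by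
    convert DeltaLaw.two_mul_le_card_filter_ne β X₀ hX₀
  obtain ⟨d, hd⟩ := Nat.exists_eq_add_of_le hcap
  let L := AlgebraicClosure k
  let φ : k →+* L := algebraMap k L
  let β₁ := DeltaLaw.baseChange22n φ β
  have hX₁ : IsUnit (X₀.map φ).det := DeltaLaw.isUnit_det_map φ hX₀
  have hcard₁ : (Finset.univ.filter fun i => β₁.f i (X₀.map φ) ≠ 0).card = 2 * n + d := by
    rw [show (Finset.univ.filter fun i => β₁.f i (X₀.map φ) ≠ 0).card =
      (Finset.univ.filter fun i => β.f i X₀ ≠ 0).card by convert DeltaLaw.card_filter_baseChange φ β X₀]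
    exact hd
  obtain ⟨β₂, hf, -, -⟩ := exists_XsideTransform β₁ (X₀.map φ) (X₀.map φ)⁻¹ 1 1
    (Matrix.mul_nonsing_inv _ hX₁) (Matrix.one_mul 1)
  have hf1 : ∀ i, β₂.f i 1 = β₁.f i (X₀.map φ) := fun i => by rw [hf, Matrix.mul_one, Matrix.mul_one]
  set O := Finset.univ.filter fun i => β₁.f i (X₀.map φ) ≠ 0 with hOdef
  have hO : ∀ i, i ∉ O → β₂.f i 1 = 0 := fun i hi => by
    rw [hf1]; by_contra h; exact hi (Finset.mem_filter.mpr ⟨Finset.mem_univ i, h⟩)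
  have hO' : ∀ i ∈ O, β₂.f i 1 ≠ 0 := fun i hi => by rw [hf1]; exact (Finset.mem_filter.mp hi).2
  let emb := Infinite.natEmbedding L
  let a : Fin (Fintype.card ι + 2 * d + 1) → L := fun i => emb i
  have ha : Function.Injective a := fun i j h => Fin.ext (emb.injective h)
  have h := seven_mul_le_two_mul_add_two_mul_one (Fintype.card ι + 2 * d) (fun i => ![1, a i])
    (DeltaLaw.pairwise_indep_of_injective a ha) d le_rfl β₂ O hO hO' hcard₁
  omega

/-- **Census form.** If `2r + 2q < 7n` then every invertible point of an `r`-term computation of `⟨2,2,n⟩` has at least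
`2n + q + 1` nonvanishing X-forms (at most `r − 2n − q − 1` vanish). -/
theorem two_mul_add_succ_le_card_filter_ne (β : BilinComp (mulBilin k 2 2 n) ι) (q : ℕ)
    (h : 2 * Fintype.card ι + 2 * q < 7 * n) (X₀ : Matrix (Fin 2) (Fin 2) k) (hX₀ : IsUnit X₀.det) :
    2 * n + q + 1 ≤ (Finset.univ.filter fun i => β.f i X₀ ≠ 0).card := by
  have h' := eleven_mul_le β X₀ hX₀
  omega

/-- **36-term `⟨2,2,11⟩` (any field; the floor rung `⌈36·11/11⌉ = 36` of the `𝔽₃` census): at every invertible point at least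
25 = 2n + 3 of the 36 X-forms are nonzero — at most 11 vanish** (plain cap 14, δ-law 13, near law / quarter law 12). -/
theorem twentyfive_le_card_filter_ne_2211_36 (β : BilinComp (mulBilin k 2 2 11) ι) (hι : Fintype.card ι = 36)
    (X₀ : Matrix (Fin 2) (Fin 2) k) (hX₀ : IsUnit X₀.det) : 25 ≤ (Finset.univ.filter fun i => β.f i X₀ ≠ 0).card :=
  two_mul_add_succ_le_card_filter_ne β 2 (by rw [hι]; norm_num) X₀ hX₀

/-- **43-term `⟨2,2,13⟩` (any field; floor rung): at least 29 = 2n + 3 of the 43 X-forms are nonzero at every invertible point.** -/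
theorem twentynine_le_card_filter_ne_2213_43 (β : BilinComp (mulBilin k 2 2 13) ι) (hι : Fintype.card ι = 43)
    (X₀ : Matrix (Fin 2) (Fin 2) k) (hX₀ : IsUnit X₀.det) : 29 ≤ (Finset.univ.filter fun i => β.f i X₀ ≠ 0).card :=
  two_mul_add_succ_le_card_filter_ne β 2 (by rw [hι]; norm_num) X₀ hX₀

/-- **56-term `⟨2,2,17⟩` (any field; floor rung): at least 38 = 2n + 4 of the 56 X-forms are nonzero at every invertible point.** -/
theorem thirtyeight_le_card_filter_ne_2217_56 (β : BilinComp (mulBilin k 2 2 17) ι) (hι : Fintype.card ι = 56)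
    (X₀ : Matrix (Fin 2) (Fin 2) k) (hX₀ : IsUnit X₀.det) : 38 ≤ (Finset.univ.filter fun i => β.f i X₀ ≠ 0).card :=
  two_mul_add_succ_le_card_filter_ne β 3 (by rw [hι]; norm_num) X₀ hX₀

/-- **72-term `⟨2,2,22⟩` (any field; floor rung): at least 49 = 2n + 5 of the 72 X-forms are nonzero at every invertible point.** -/
theorem fortynine_le_card_filter_ne_2222_72 (β : BilinComp (mulBilin k 2 2 22) ι) (hι : Fintype.card ι = 72)
    (X₀ : Matrix (Fin 2) (Fin 2) k) (hX₀ : IsUnit X₀.det) : 49 ≤ (Finset.univ.filter fun i => β.f i X₀ ≠ 0).card :=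
  two_mul_add_succ_le_card_filter_ne β 4 (by rw [hι]; norm_num) X₀ hX₀

end AnyField

end NearSplit

end Summit.MatrixMultiplication.OmegaCensus.SmallFormats
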